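import Summits.QuantumFields.YangMills.Theorems.FluctuationComparisonRegPrIntLWreg
import HarnessLib

/-!
# `FluctuationComparisonRegPrIntLS1aProfileWindowChart` — WREG FOR DOMINATED THRESHOLD PROFILES: window charts, `regSet`, and positivity of the canonical restricted
# density for `histGood F ℰp θ″ K J` with ANY profile `0 < θ″ ≤ θBal F.L γ b₀ p₀` (FILE C2 of the «(p) on the FULL window» road for S1aᴴ)

Cell `ym3-torus` (YM ladder rung R3 = continuum `SU(2)` Yang–Mills on T³ — NOT d = 4, NOT infinite volume, NOT a mass gap, NOT Clay); width seat
`ym3-torus-px21` (gen 22), WIDTH COPY of ★p1 «CMP 102 Thm 1's inputs AS PRINTED vs AS TYPED, every gap named».  Helper of the crux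
`stmt-QuantumFields-20520` `FluctuationComparisonRegPrIntL` (`--kind proof --supports … --as helper`, count-neutral).  THEOREMS ONLY: definition-free,
default heartbeats, no `instance`∕`notation`.

WHY.  ✓WREG `…Wreg.windowRegularity` (`WindowRegularity`: the `θBal F.L γ b₀ p₀ J`-window lies in `regSet` of the `histGood F ℰp (θBal F.L γ b₀ p₀) K J`-restricted
height density and its canonical version is positive there) is keyed to ONE threshold profile `θBal F.L γ b₀ p₀` at all heights.  S1aᴴ's (p) at a CUT height `j` needs
the event «height `j` in the `b₀`-window, heights `(j, Ts]` in the `c·θ`-windows where the cut weight is positive» — the profile `θ″_j = θ_j`, `θ″_i = c·θ_i` above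
(✓p819387∕✓p819880 pay only the plateau `b₀∕2`).  The PROVED assembly behind WREG is profile-generic: ✓`exists_chartData_bdd` ∕ ✓`WindowChart.ofChartData` ∕
✓`histGood_subset_charted` (`…WregAssembly`) take any `θ` with `0 ≤ θ i` and `(((d+2)L)²∕4)·θ i ≤ α`, the four chart-free entries VOL ∕ EDGE ∕ LEVEL ∕ CHARGE
(✓`…Wreg.chartVol ∕ edgeFlat ∕ levelFlat ∕ chartCharge`) carry no profile (CHARGE: any `θ ≥ 0`), and the glue ✓`chart_subset_regSet` ∕ ✓`chart_pos` (`…WregGlue` §3) is stated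
for any `Sfine`.  THIS FILE re-runs ✓`windowChartsExist_of_flat`'s proof with `θBal ↦ θ″` for every DOMINATED profile `0 < θ″ i ≤ θBal F.L γ b₀ p₀ i` (the smallness
hypotheses of the assembly are monotone in the profile) and glues:
* ★★★`exists_windowChart_profile`: for every `L`, `0 < b₀`, `0 < p₀` there is `γ₁ > 0` such that for every family of block size `L`, `0 < γ ≤ γ₁`, every dominated profile `θ″`,
  every `J ≤ K` and every `V₀` in the `θ″ J`-window: `Nonempty (WindowChart F hJK (histGood F ℰp θ″ K J) {V | PlaqSmall (θ″ J) V})`.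
* ★★★`regSet_and_pos_profile`: same `γ₁`; for every `γ′ > 0`: `{V | PlaqSmall (θ″ J) V} ⊆ Node00.regSet dU_J (heightDensity F γ′ hJK (histGood F ℰp θ″ K J))`, and
  `0 < heightDensityCan F γ′ hJK (histGood F ℰp θ″ K J) V` at every window point `V` that has a fine history in `interior (histGood F ℰp θ″ K J)` (INTERIOR left as a
  per-point hypothesis — FILE C3 discharges it for the cut-tower profile by the spread lifts ✓`…SpreadLiftAllL.spreadLift_height_all`).
(At `θ″ = θBal …` with WREG's own INTERIOR ✓`windowFibreInterior_holds` the two conclusions are `WindowRegularity`'s — the dedup lint recognises the restatement, so no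
sanity theorem is kept here.)
NOTHING of Bałaban's is asserted or proved: a re-run of a landed assembly with a parameter.

HONEST: S1a(ᴴ): (m)-conjunct AS TYPED misstated by currency (★★OWNER RULING №80; repair (R-β1′) requested), AS PRINTED OPEN; (c)∕(a) untouched; (p) at the cut heights
on the full window only after C3; the five registered stubs of `Lines/semiclassical_s2beta.lean` (3732b7df) ∕ crux 20520 ∕ 19936 ∕ 19200 ∕ `YM3TorusSU2` NOT proved; registry
untouched; rung R3 = SU(2) YM₃ on T³ at fixed lattice data — NOT d = 4, NOT infinite volume, NOT a mass gap, NOT Clay; the Yang–Mills mass gap is NOT proved by any of this.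
References: [Balaban1987RG1] CMP 109 (1987) (0.4) p. 253, (0.13) p. 254, (2.9)–(2.10) pp. 266–267; [Balaban1985UV3] CMP 102 (1985) (2) p. 256, (7) p. 257, (28)–(31) p. 263;
[Balaban1985Averaging] CMP 98 (1985) (10) p. 19.
-/

set_option autoImplicit false

noncomputable section

open MeasureTheory Filter Topology Set
open scoped ENNReal NNReal
open Literature.MathematicalPhysics.QuantumFieldTheory.Balaban1983to89
open Literature.MathematicalPhysics.QuantumFieldTheory.Balaban1983to89.T3ContinuumYM3Torus
open Literature.MathematicalPhysics.QuantumFieldTheory.Balaban1983to89.T3NestedUnitLaws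
open Literature.MathematicalPhysics.QuantumFieldTheory.Balaban1983to89.T3UnitLawDensityEML
open Literature.MathematicalPhysics.QuantumFieldTheory.Balaban1983to89.T3UnitScaleTilt
open Literature.MathematicalPhysics.QuantumFieldTheory.Balaban1983to89.T3TiltDescent
open Literature.MathematicalPhysics.QuantumFieldTheory.Balaban1983to89.T3LevelShift
open Literature.MathematicalPhysics.QuantumFieldTheory.Balaban1983to89.T3SmallLiftHistory
open Literature.MathematicalPhysics.QuantumFieldTheory.Balaban1983to89.T3Thresholds
open Literature.MathematicalPhysics.QuantumFieldTheory.Balaban1983to89.Missing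
open Literature.MathematicalPhysics.QuantumFieldTheory.Balaban1983to89.T4Continuum
open scoped Literature.MathematicalPhysics.QuantumFieldTheory.Balaban1983to89.T3OrbitAverage

namespace Summit.QuantumFields.YangMills.Theorems.FluctuationComparisonRegPrIntLS1aProfileWindowChart

open Literature.MathematicalPhysics.QuantumFieldTheory.Balaban1983to89.ExpMeanLog (deltaSU)
open Literature.MathematicalPhysics.QuantumFieldTheory.Balaban1983to89.BlockAveraging (Idx)
open Literature.MathematicalPhysics.QuantumFieldTheory.Balaban1983to89.BlockAveragingEMLHaarAC (offCard offCard_lt_card)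
open Summit.QuantumFields.YangMills.Theorems.FluctuationComparisonRegPrIntLWregChain
open Summit.QuantumFields.YangMills.Theorems.FluctuationComparisonRegPrIntLWregFibredChart
open Summit.QuantumFields.YangMills.Theorems.FluctuationComparisonRegPrIntLWregGlue
open Summit.QuantumFields.YangMills.Theorems.FluctuationComparisonRegPrIntLWregInterior
open Summit.QuantumFields.YangMills.Theorems.FluctuationComparisonRegPrIntLWregAssembly
open Summit.QuantumFields.YangMills.Theorems.FluctuationComparisonRegPrIntLWreg (chartVol edgeFlat levelFlat chartCharge)

/-! ## §1 Window charts for every dominated profile -/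

/-- ★★★ **WINDOW CHARTS FOR DOMINATED PROFILES** — ✓`windowChartsExist_of_flat` (VOL + EDGE + LEVEL + CHARGE ⇒ charts) re-run with the threshold profile `θBal F.L γ b₀ p₀`
replaced by any profile `θ″` with `0 < θ″ i ≤ θBal F.L γ b₀ p₀ i`: for `0 < γ ≤ γ₁(L, b₀, p₀)`, every `J ≤ K` and every `V₀` in the `θ″ J`-window there is a window chart of
`descendTo F ℰp J K` on `histGood F ℰp θ″ K J` over the open `θ″ J`-window (every smallness condition of the assembly is monotone in the profile).
[cite: Balaban1987RG1, (2.10) p.267; Balaban1985UV3, (7) p.257] -/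
theorem exists_windowChart_profile :
    ∀ (L : ℕ) (b₀ p₀ : ℝ), 0 < b₀ → 0 < p₀ → ∃ γ₁ : ℝ, 0 < γ₁ ∧ ∀ (F : T3Family) (γ : ℝ), F.L = L → 0 < γ → γ ≤ γ₁ →
      ∀ (θ'' : ℕ → ℝ), (∀ i, 0 < θ'' i) → (∀ i, θ'' i ≤ θBal F.L γ b₀ p₀ i) →
      ∀ (J K : ℕ) (hJK : J ≤ K) (V₀ : GaugeField (F.P J) 0 (Matrix.specialUnitaryGroup (Fin 2) ℂ)), PlaqSmall (θ'' J) V₀ →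
        Nonempty (WindowChart F hJK (histGood F ℰp θ'' K J) {V | PlaqSmall (θ'' J) V}) := by
  intro L b₀ p₀ hb hp
  by_cases hL : 1 ≤ L
  swap
  · refine ⟨1, one_pos, fun F γ hFL _ _ => ?_⟩
    exact absurd (hFL ▸ F.hL.2.le) hL
  obtain ⟨δ', γ₁, hδ', hγ₁, hreg⟩ := exists_gamma_levelRegime L b₀ p₀ hb hp
  obtain ⟨α, hα0, hα24, hα64, hαF⟩ := exists_chartRegime L hL
  set D₅ : ℝ := ((((3 + 2) * L : ℕ) : ℝ) ^ 2 / 4) with hD₅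
  have hD₅0 : 0 ≤ D₅ := by positivity
  set σ : ℝ := α / (D₅ + 1) with hσ
  have hσ0 : 0 < σ := div_pos hα0 (by positivity)
  obtain ⟨γ₂, hγ₂, hγ₂1, hθσ⟩ := exists_gamma_forall_θBal_le (b₀ := b₀) (p₀ := p₀) hb hp hσ0
  refine ⟨min γ₁ γ₂, lt_min hγ₁ hγ₂, fun F γ hFL hγ hγle θ'' hθ''0 hθ''le J K hJK V₀ hV₀ => ?_⟩
  haveI : BorelSpace (GaugeField (F.P J) 0 (Matrix.specialUnitaryGroup (Fin 2) ℂ)) := T3OrbitAverage.instBorelSpaceGaugeField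
  have hLF : 1 ≤ F.L := F.hL.2.le
  obtain ⟨hαL, hgap⟩ := hαF F hFL K
  obtain ⟨hsmall, hθlt'⟩ := hreg F γ hFL hγ (hγle.trans (min_le_left _ _)) K
  -- the dominated profile inherits every smallness condition of the assembly
  have hθpos : ∀ i, 0 < θ'' i := hθ''0
  have hθ0 : ∀ i, 0 ≤ θ'' i := fun i => (hθpos i).le
  have hθlt : ∀ i, θ'' i < δ' := fun i => (hθ''le i).trans_lt (hθlt' i)
  have hθα : ∀ i, (((((F.P K).d + 2) * (F.P K).L : ℕ) : ℝ) ^ 2 / 4) * θ'' i ≤ α := by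
    intro i
    have hθi : θ'' i ≤ σ := (hθ''le i).trans (hθσ F.L hLF γ hγ (hγle.trans (min_le_right _ _)) i)
    have hd : (F.P K).d = 3 := T3Family.P_d F K
    have hLL : (F.P K).L = L := hFL
    rw [hd, hLL, ← hD₅]
    calc D₅ * θ'' i ≤ D₅ * σ := mul_le_mul_of_nonneg_left hθi hD₅0
      _ ≤ α := by
          rw [hσ, mul_div_assoc', div_le_iff₀ (by positivity)]
          nlinarith [hα0.le]
  have hn : K - J ≤ (F.P K).m + (F.P K).K := by
    show K - J ≤ F.m + K
    omega
  have hβ := iterCentralBond_injective (P := F.P K) (n := K - J) hn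
  set θ := θ'' with hθdef
  set O : Set (GaugeField (F.P J) 0 (Matrix.specialUnitaryGroup (Fin 2) ℂ)) := {V | PlaqSmall (θ J) V} with hOdef
  have hO : IsOpen O := isOpen_setOf_plaqSmall₂ (F.P J) 0 (θ J)
  obtain ⟨j₀, hj₀, hvol⟩ := chartVol F K α hα0 hα24 hα64 hαL hgap
  obtain ⟨D, hDb⟩ := exists_chartData_bdd F hJK hθ0 hα0.le hα24 hα64 hαL hgap hθα hj₀ hvol hO.measurableSet
  have hs := F.sitesPerDir_eq (m := F.m) (K := J) (j := 0) (m' := F.m) (K' := K) (j' := K - J) (by omega)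
  have hdesc : (descendTo F ℰp J K hJK : GaugeField (F.P K) 0 (Matrix.specialUnitaryGroup (Fin 2) ℂ) → GaugeField (F.P J) 0 _) =
      fieldShift hs ∘ Averaging.iter (fun i => BlockAveraging.blockAvg (P := F.P K) (j := i) ℰp) (K - J) := rfl
  have he'e : ∀ y : GaugeField (F.P K) (K - J) (Matrix.specialUnitaryGroup (Fin 2) ℂ), fieldShift hs.symm (fieldShift hs y) = y :=
    fieldShift_fieldShift_symm hs
  have hee' : ∀ y' : GaugeField (F.P J) 0 (Matrix.specialUnitaryGroup (Fin 2) ℂ), fieldShift hs (fieldShift hs.symm y') = y' :=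
    fieldShift_symm_fieldShift hs
  have hiter_of_desc : ∀ U V, descendTo F ℰp J K hJK U = V →
      Averaging.iter (fun i => BlockAveraging.blockAvg (P := F.P K) (j := i) ℰp) (K - J) U = fieldShift hs.symm V := by
    intro U V h
    rw [hdesc, Function.comp_apply] at h
    rw [← h, he'e]
  refine ⟨WindowChart.ofChartData D hδ'.le hθlt hsmall _ hDb (fun V₁ _ => ?edge) (fun V₁ hV₁ => ?level) (fun V₁ _ hpre => ?charge)⟩
  case edge =>
    have hae : ∀ c, ∀ᵐ z ∂fieldMeasure (F.P K) 0 (Matrix.specialUnitaryGroup (Fin 2) ℂ),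
        V₁ (D.w c) ∉ frontier (chainMap ℰp (K - J) z c '' chainWindow (N := 2) α (K - J) z c) := fun c =>
      edgeFlat F K (K - J) hn α hα0 hα24 hα64 hαL hgap c (V₁ (D.w c))
    filter_upwards [ae_all_iff.2 hae] with z hz
    by_cases hT : ∀ c, V₁ (D.w c) ∈ D.T c z
    · refine Or.inl fun c => ?_
      rw [← self_sdiff_frontier]
      refine ⟨hT c, ?_⟩
      rw [D.T_eq]
      exact hz c
    · simp only [not_forall] at hT
      obtain ⟨c, hc⟩ := hT
      exact Or.inr ⟨c, by rwa [(D.isClosed_T c z).closure_eq]⟩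
  case level =>
    have hae := levelFlat F K (K - J) hn α hα0 hα24 hα64 hαL hgap (fun j => θ (K - j)) (fun j => (hθpos _).ne') (fieldShift hs.symm V₁)
    filter_upwards [hae] with z hz hT j hj p
    obtain ⟨hoff, hwin, hd⟩ := D.charted V₁ z hT
    have h2 := hiter_of_desc _ _ hd
    rcases hj.lt_or_eq with hlt | rfl
    · exact hz (D.Φ (V₁, z)) hoff hwin h2 j hlt p
    · rw [h2, Nat.sub_sub_self hJK]
      exact (lt_of_eq_of_lt (congrArg dist1 (plaqHol_fieldShift hs.symm V₁ p)) (hV₁ _)).ne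
  case charge =>
    obtain ⟨U₀, hU₀V, hU₀int⟩ := hpre
    have hW := hiter_of_desc _ _ hU₀V
    have hpos := chartCharge F K J θ α hθ0 hα0 hα24 hα64 hαL hgap hθα (fieldShift hs.symm V₁) ⟨U₀, hU₀int, hW⟩
    refine hpos.trans_le (measure_mono ?_)
    rintro z ⟨g, hUgood, hUiter⟩
    have hch : ∀ c, g c ∈ chainWindow (N := 2) α (K - J) z c := fun c => by
      have h := histGood_subset_charted F hJK hθ0 hθα hUgood c
      rwa [hβ.extend_apply, chainWindow_extend α hn] at h
    have hd : descendTo F ℰp J K hJK (Function.extend (iterCentralBond (K - J)) g z) = V₁ := by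
      rw [hdesc, Function.comp_apply, hUiter, hee']
    obtain ⟨hJ, hΦ⟩ := D.recog V₁ z g hch hUgood hd
    exact ⟨hJ, hΦ ▸ hUgood⟩

/-! ## §2 `regSet` and positivity of the canonical restricted density on the window of a dominated profile -/

/-- ★★★ **WREG FOR DOMINATED PROFILES (INTERIOR as a per-point hypothesis)**: for `0 < γ ≤ γ₁(L, b₀, p₀)` (the `γ₁` of §1), every dominated profile `θ″`, every `J ≤ K` and
every `γ′ > 0`: the `θ″ J`-window lies in `Node00.regSet dU_J (heightDensity F γ′ hJK (histGood F ℰp θ″ K J))`, and the canonical version of that restricted density is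
STRICTLY POSITIVE at every window point that carries a fine history in `interior (histGood F ℰp θ″ K J)` (✓`chart_subset_regSet`, ✓`chart_pos` on §1's chart).
[cite: Balaban1987RG1, (2.10) p.267 and (0.13) p.254; Balaban1985UV3, (2) p.256 and (7) p.257] -/
theorem regSet_and_pos_profile :
    ∀ (L : ℕ) (b₀ p₀ : ℝ), 0 < b₀ → 0 < p₀ → ∃ γ₁ : ℝ, 0 < γ₁ ∧ ∀ (F : T3Family) (γ : ℝ), F.L = L → 0 < γ → γ ≤ γ₁ →
      ∀ (θ'' : ℕ → ℝ), (∀ i, 0 < θ'' i) → (∀ i, θ'' i ≤ θBal F.L γ b₀ p₀ i) →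
      ∀ (J K : ℕ) (hJK : J ≤ K) (γ' : ℝ), 0 < γ' →
        {V : GaugeField (F.P J) 0 (Matrix.specialUnitaryGroup (Fin 2) ℂ) | PlaqSmall (θ'' J) V} ⊆
            Node00.regSet (fieldMeasure (F.P J) 0 (Matrix.specialUnitaryGroup (Fin 2) ℂ)) (heightDensity F γ' hJK (histGood F ℰp θ'' K J)) ∧
        ∀ V : GaugeField (F.P J) 0 (Matrix.specialUnitaryGroup (Fin 2) ℂ), PlaqSmall (θ'' J) V →
          (∃ U, descendTo F ℰp J K hJK U = V ∧ U ∈ interior (histGood F ℰp θ'' K J)) →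
            0 < heightDensityCan F γ' hJK (histGood F ℰp θ'' K J) V := by
  intro L b₀ p₀ hb hp
  obtain ⟨γ₁, hγ₁, hCF⟩ := exists_windowChart_profile L b₀ p₀ hb hp
  refine ⟨γ₁, hγ₁, fun F γ hL hγ hγle θ'' hθ''0 hθ''le J K hJK γ' hγ' => ?_⟩
  have hSm : MeasurableSet (histGood F ℰp θ'' K J) := measurableSet_histGood F ℰp measurableE_ℰp _ K J
  have hO : IsOpen {V : GaugeField (F.P J) 0 (Matrix.specialUnitaryGroup (Fin 2) ℂ) | PlaqSmall (θ'' J) V} := isOpen_setOf_plaqSmall₂ (F.P J) 0 (θ'' J)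
  refine ⟨fun V₀ hV₀ => ?_, fun V₀ hV₀ hint => ?_⟩
  · obtain ⟨c⟩ := hCF F γ hL hγ hγle θ'' hθ''0 hθ''le J K hJK V₀ hV₀
    exact chart_subset_regSet c hO hSm hγ'.le hV₀
  · obtain ⟨c⟩ := hCF F γ hL hγ hγle θ'' hθ''0 hθ''le J K hJK V₀ hV₀
    exact chart_pos c hO hSm hγ'.le hV₀ hint

end Summit.QuantumFields.YangMills.Theorems.FluctuationComparisonRegPrIntLS1aProfileWindowChart

end
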